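import Summits.Schanuel.Schanuel.Theorems.ZilberEacParamFibreCurveGap
import Summits.Schanuel.Schanuel.Theorems.ZilberEacParamSurfaceTransport
import HarnessLib

/-!
# Polynomially parametrised base curves, XLI: the Puiseux gap — complete theorem, literal
# capstones (incl. the rational leading ratio), the master capstone updated, and examples

HONEST FRAMING.  Cell `pub-schanuel` (Zilber's Exponential-Algebraic Closedness, case ladder;
host summit Schanuel), seat 2, gen 21.  Assembly of file XL (gap theorem) with the trichotomy
(XXII), the dictionary (XXIV), the transport (XXXVII) and the earlier regimes:
* `unprojectedDensityQuestion_paramSurface₃_complete₃`: `2 ≤ d = deg g₀ < n = deg g₁` and ONE of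
  `d ∤ n`, `Re(lc(g₁)(i/lc(g₀))^{n/d}) ≠ 0`, `n - d < deg(lc(g₀)^{n/d} g₁ - lc(g₁) g₀^{n/d})` (the
  GAP; gen 20's sub-leading condition is its top case) ⟹ every irreducible `Q ∈ ℂ[t, y₀, y₁]` with
  a zero in `(ℂˣ)²` over infinitely many `t` gives a surface of the case with dense exponential
  points; literal capstones `unprojectedDense_of_mmCase_of_base_eq_paramCurve₃` (+ `_of_gt`);
* the rational leading ratio through the gap: `unprojectedDense_of_mmCase_of_base_eq_paramCurve_of_ratRatio₃`;
* `unprojectedDense_of_mmCase_of_base_eq_paramCurve_master₂`: the master capstone of XXXVI with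
  the gap alternatives and the rational-ratio regime added;
* examples: EVERY `W` of the case over `(x₁ - i x₀²)³ = x₀⁴` (`(t³, i t⁶ + t⁴)`: `3 ∣ 6`,
  vanishing phase, proportional sub-leading coefficients, gap at `m = 4 = n - 2` — NEW), and the
  plain-coordinate fibre curve `{x₀ = y₀², x₁ = y₀² + y₀}` over `(x₁ - x₀)² = x₀` (equal degrees,
  RATIONAL real ratio `1` — NEW; compare `√2` in XXXII).
What stays OPEN: fibre curves with `d ∣ n`, vanishing phase and `deg D ≤ n - d`; non-split `Q`
over real-ratio curves without gen 20's curvature condition; general algebraic curves; Fib(3,2);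
EC(3,2).  Mantova–Masser's question is OPEN in general (PLMS 2024 §1 p. 5); NOT Schanuel's
conjecture (neither used nor implied; EAC ⇏ SC).
-/

noncomputable section

open Filter Topology Set Complex MvPolynomial
open Literature.NumberTheory.Transcendental Literature.ModelTheory.Zilber
open Literature.ModelTheory.ExponentialFields

set_option linter.dupNamespace false

namespace Summit.Schanuel.Schanuel.Theorems

section Main

variable (g₀ g₁ : Polynomial ℂ) {Q : MvPolynomial (Fin 3) ℂ}

/-- **Complete theorem across the gap (`2 ≤ deg g₀ < deg g₁`, `d ∣ n`, vanishing phase, gap).**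
Every irreducible `Q ∈ ℂ[t, y₀, y₁]` with a zero in `(ℂˣ)²` over infinitely many `t` gives a surface
`S(g; Q)` of Mantova–Masser's case with Zariski-dense exponential points. [cite: MantovaMasser2023,
§1 Further remarks, p. 5 (the question, open in general)] (new) -/
theorem unprojectedDensityQuestion_paramSurface₃_complete_of_gap (hd : 2 ≤ g₀.natDegree)
    (hlt : g₀.natDegree < g₁.natDegree) (hdvd : g₀.natDegree ∣ g₁.natDegree)
    (hph0 : (g₁.leadingCoeff * (I / g₀.leadingCoeff) ^ (g₁.natDegree / g₀.natDegree)).re = 0)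
    (hgap : g₁.natDegree < (Polynomial.C (g₀.leadingCoeff ^ (g₁.natDegree / g₀.natDegree)) * g₁ -
        Polynomial.C g₁.leadingCoeff * g₀ ^ (g₁.natDegree / g₀.natDegree)).natDegree +
      g₀.natDegree)
    (hirr : Irreducible Q)
    (hfib : Set.Infinite {t : ℂ | ∃ c : Fin 2 → ℂ, c 0 ≠ 0 ∧ c 1 ≠ 0 ∧
      MvPolynomial.eval ![t, c 0, c 1] Q = 0}) :
    MMCaseDimPiOneFree {w : Fin 2 ⊕ Fin 2 → ℂ | ∃ t : ℂ, w (Sum.inl 0) = g₀.eval t ∧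
        w (Sum.inl 1) = g₁.eval t ∧
        MvPolynomial.eval (Fin.cases t (fun i => w (Sum.inr i)) : Fin 3 → ℂ) Q = 0} ∧
      UnprojectedDense {w : Fin 2 ⊕ Fin 2 → ℂ | ∃ t : ℂ, w (Sum.inl 0) = g₀.eval t ∧
        w (Sum.inl 1) = g₁.eval t ∧
        MvPolynomial.eval (Fin.cases t (fun i => w (Sum.inr i)) : Fin 3 → ℂ) Q = 0} := by
  rcases two_y1_degrees_or_y0_of_torusFibres hirr hfib with h2 | ⟨hQ2, h1⟩
  · exact unprojectedDensityQuestion_instance_paramSurface₃ g₀ g₁ (by omega) hlt hirr h2 hfib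
  · exact unprojectedDensityQuestion_instance_paramSurface₃_of_y0_gap g₀ g₁ hd hlt hdvd hph0 hgap
      hirr hQ2 h1 (fibreRoots_infinite_of_torusFibres hQ2 hfib)

/-- **Complete theorem over a polynomial curve with `2 ≤ deg g₀ < deg g₁`, three alternatives.**
One of: `d ∤ n`; `Re(lc(g₁)(i/lc(g₀))^{n/d}) ≠ 0`; the GAP
`n - d < deg(lc(g₀)^{n/d} g₁ - lc(g₁) g₀^{n/d})` — then every irreducible `Q` with a zero in
`(ℂˣ)²` over infinitely many `t` gives a surface of the case with dense exponential points.
(Supersedes `…complete₂`: its sub-leading alternative is the top case of the gap.)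
[cite: MantovaMasser2023, §1 Further remarks, p. 5 (the question, open in general)] (new) -/
theorem unprojectedDensityQuestion_paramSurface₃_complete₃ (hd : 2 ≤ g₀.natDegree)
    (hlt : g₀.natDegree < g₁.natDegree)
    (h : ¬ g₀.natDegree ∣ g₁.natDegree ∨
      (g₁.leadingCoeff * (I / g₀.leadingCoeff) ^ (g₁.natDegree / g₀.natDegree)).re ≠ 0 ∨
      g₁.natDegree < (Polynomial.C (g₀.leadingCoeff ^ (g₁.natDegree / g₀.natDegree)) * g₁ -
          Polynomial.C g₁.leadingCoeff * g₀ ^ (g₁.natDegree / g₀.natDegree)).natDegree +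
        g₀.natDegree)
    (hirr : Irreducible Q)
    (hfib : Set.Infinite {t : ℂ | ∃ c : Fin 2 → ℂ, c 0 ≠ 0 ∧ c 1 ≠ 0 ∧
      MvPolynomial.eval ![t, c 0, c 1] Q = 0}) :
    MMCaseDimPiOneFree {w : Fin 2 ⊕ Fin 2 → ℂ | ∃ t : ℂ, w (Sum.inl 0) = g₀.eval t ∧
        w (Sum.inl 1) = g₁.eval t ∧
        MvPolynomial.eval (Fin.cases t (fun i => w (Sum.inr i)) : Fin 3 → ℂ) Q = 0} ∧
      UnprojectedDense {w : Fin 2 ⊕ Fin 2 → ℂ | ∃ t : ℂ, w (Sum.inl 0) = g₀.eval t ∧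
        w (Sum.inl 1) = g₁.eval t ∧
        MvPolynomial.eval (Fin.cases t (fun i => w (Sum.inr i)) : Fin 3 → ℂ) Q = 0} := by
  by_cases hph : ¬ g₀.natDegree ∣ g₁.natDegree ∨
      (g₁.leadingCoeff * (I / g₀.leadingCoeff) ^ (g₁.natDegree / g₀.natDegree)).re ≠ 0
  · exact unprojectedDensityQuestion_paramSurface₃_complete g₀ g₁ hd hlt hph hirr hfib
  · push Not at hph
    obtain ⟨hdvd, hph0⟩ := hph
    have hgap : g₁.natDegree <
        (Polynomial.C (g₀.leadingCoeff ^ (g₁.natDegree / g₀.natDegree)) * g₁ -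
          Polynomial.C g₁.leadingCoeff * g₀ ^ (g₁.natDegree / g₀.natDegree)).natDegree +
        g₀.natDegree := by
      rcases h with h | h | h
      · exact absurd hdvd h
      · exact absurd hph0 h
      · exact h
    exact unprojectedDensityQuestion_paramSurface₃_complete_of_gap g₀ g₁ hd hlt hdvd hph0 hgap
      hirr hfib

/-- **LITERAL CAPSTONE, three alternatives.**  Every `W ⊆ ℂ² × ℂ²` in Mantova–Masser's case
(dim-π-S-1-free) whose base curve is `{(g₀(t), g₁(t))}` with `2 ≤ deg g₀ < deg g₁` and one of
`d ∤ n`, non-vanishing phase, the gap, has Zariski-dense exponential points.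
[cite: MantovaMasser2023, §1 Further remarks, p. 5 (the question, open in general)] (new) -/
theorem unprojectedDense_of_mmCase_of_base_eq_paramCurve₃ (hd : 2 ≤ g₀.natDegree)
    (hlt : g₀.natDegree < g₁.natDegree)
    (h : ¬ g₀.natDegree ∣ g₁.natDegree ∨
      (g₁.leadingCoeff * (I / g₀.leadingCoeff) ^ (g₁.natDegree / g₀.natDegree)).re ≠ 0 ∨
      g₁.natDegree < (Polynomial.C (g₀.leadingCoeff ^ (g₁.natDegree / g₀.natDegree)) * g₁ -
          Polynomial.C g₁.leadingCoeff * g₀ ^ (g₁.natDegree / g₀.natDegree)).natDegree +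
        g₀.natDegree)
    {W : Set (Fin 2 ⊕ Fin 2 → ℂ)} (hmm : MMCaseDimPiOneFree W)
    (hbase : zeroLocus ℂ (vanishingIdeal ℂ (projAdd '' (W ∩ torusLocus ℂ 2))) =
      {x : Fin 2 → ℂ | ∃ t : ℂ, x 0 = g₀.eval t ∧ x 1 = g₁.eval t}) :
    UnprojectedDense W := by
  obtain ⟨Q, hQ, hfib, rfl⟩ := exists_eq_paramSurface₃_of_mmCase g₀ g₁ (by omega) hmm hbase
  exact (unprojectedDensityQuestion_paramSurface₃_complete₃ g₀ g₁ hd hlt h hQ hfib).2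

/-- **LITERAL CAPSTONE, three alternatives, mirror** (`2 ≤ deg g₁ < deg g₀`).
[cite: MantovaMasser2023, §1 Further remarks, p. 5 (the question, open in general)] (new) -/
theorem unprojectedDense_of_mmCase_of_base_eq_paramCurve₃_of_gt (hd : 2 ≤ g₁.natDegree)
    (hlt : g₁.natDegree < g₀.natDegree)
    (h : ¬ g₁.natDegree ∣ g₀.natDegree ∨
      (g₀.leadingCoeff * (I / g₁.leadingCoeff) ^ (g₀.natDegree / g₁.natDegree)).re ≠ 0 ∨
      g₀.natDegree < (Polynomial.C (g₁.leadingCoeff ^ (g₀.natDegree / g₁.natDegree)) * g₀ -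
          Polynomial.C g₀.leadingCoeff * g₁ ^ (g₀.natDegree / g₁.natDegree)).natDegree +
        g₁.natDegree)
    {W : Set (Fin 2 ⊕ Fin 2 → ℂ)} (hmm : MMCaseDimPiOneFree W)
    (hbase : zeroLocus ℂ (vanishingIdeal ℂ (projAdd '' (W ∩ torusLocus ℂ 2))) =
      {x : Fin 2 → ℂ | ∃ t : ℂ, x 0 = g₀.eval t ∧ x 1 = g₁.eval t}) :
    UnprojectedDense W := by
  obtain ⟨Q, hQ, hfib, rfl⟩ := exists_eq_paramSurface₃_of_mmCase g₀ g₁ (by omega) hmm hbase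
  obtain ⟨-, hdns⟩ := unprojectedDensityQuestion_paramSurface₃_complete₃ g₁ g₀ hd hlt h
    (irreducible_rename_swap12 hQ) (torusFibres_rename_swap12 hfib)
  rw [paramSurface₃_eq_indexSwapped, unprojectedDense_indexSwapped_iff]
  exact hdns

end Main

/-! ## The rational leading ratio through the gap, and the master capstone updated -/

section RatRatio

variable (g₀ g₁ : Polynomial ℂ) {p q u v : ℤ}

/-- **RATIONAL LEADING RATIO, three alternatives on the reduced pair.**  `deg g₀ = deg g₁ = n ≥ 2`,
`p lc(g₀) + q lc(g₁) = 0`, `p u + q v = 1`; `G = p g₀ + q g₁` (degree `m < n`), `H = u g₁ - v g₀`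
(degree `n`).  If `m ≥ 2` and one of `m ∤ n`, `Re(lc(H)(i/lc(G))^{n/m}) ≠ 0`,
`n - m < deg(lc(G)^{n/m} H - lc(H) G^{n/m})`, then every `W` of Mantova–Masser's case over
`{(g₀(t), g₁(t))}` has Zariski-dense exponential points. [cite: MantovaMasser2023, §1 Further
remarks, p. 5 (the question, open in general)] (new) -/
theorem unprojectedDense_of_mmCase_of_base_eq_paramCurve_of_ratRatio₃ (hbez : p * u + q * v = 1)
    (hn : 2 ≤ g₀.natDegree) (heq : g₁.natDegree = g₀.natDegree)
    (hpq : (p : ℂ) * g₀.leadingCoeff + (q : ℂ) * g₁.leadingCoeff = 0)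
    {G H : Polynomial ℂ} (hG : G = Polynomial.C (p : ℂ) * g₀ + Polynomial.C (q : ℂ) * g₁)
    (hH : H = Polynomial.C (u : ℂ) * g₁ - Polynomial.C (v : ℂ) * g₀)
    (hm : 2 ≤ G.natDegree)
    (hreg : ¬ G.natDegree ∣ g₀.natDegree ∨
      (H.leadingCoeff * (I / G.leadingCoeff) ^ (g₀.natDegree / G.natDegree)).re ≠ 0 ∨
      g₀.natDegree < (Polynomial.C (G.leadingCoeff ^ (g₀.natDegree / G.natDegree)) * H -
          Polynomial.C H.leadingCoeff * G ^ (g₀.natDegree / G.natDegree)).natDegree +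
        G.natDegree)
    {W : Set (Fin 2 ⊕ Fin 2 → ℂ)} (hmm : MMCaseDimPiOneFree W)
    (hbase : zeroLocus ℂ (vanishingIdeal ℂ (projAdd '' (W ∩ torusLocus ℂ 2))) =
      {x : Fin 2 → ℂ | ∃ t : ℂ, x 0 = g₀.eval t ∧ x 1 = g₁.eval t}) :
    UnprojectedDense W := by
  have hHd := (natDegree_ratRed_snd g₀ g₁ hbez (by omega) heq hpq hH).1
  have hlt : G.natDegree < H.natDegree := by
    rw [hHd]; exact natDegree_ratRed_lt g₀ g₁ (by omega) heq hpq hG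
  refine unprojectedDense_of_mmCase_of_base_eq_paramCurve_bezout g₀ g₁ hbez hG hH
    (fun W' hW' hb' => ?_) hmm hbase
  refine unprojectedDense_of_mmCase_of_base_eq_paramCurve₃ G H hm hlt ?_ hW' hb'
  rw [hHd]
  exact hreg

/-- **MASTER CAPSTONE over polynomially parametrised base curves, second edition.**  Let
`deg g₀, deg g₁ ≥ 2` and assume ONE of: (i) `deg g₀ < deg g₁` with [`d ∤ n` or non-vanishing phase
or the gap]; (ii) the mirror of (i); (iii) `deg g₀ = deg g₁` with non-real leading ratio;
(iv) `deg g₀ = deg g₁` with real irrational leading ratio and `lc(g₀)(g₁)_{n-1} ≠ lc(g₁)(g₀)_{n-1}`;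
(v) `deg g₀ = deg g₁` with RATIONAL leading ratio `p lc₀ + q lc₁ = 0`, `p u + q v = 1`, and the
reduced pair `(p g₀ + q g₁, u g₁ - v g₀)` in regime (i).  Then EVERY `W ⊆ ℂ² × ℂ²` of
Mantova–Masser's case whose base curve is `{(g₀(t), g₁(t))}` has Zariski-dense exponential points.
[cite: MantovaMasser2023, §1 Further remarks, p. 5 (the question, open in general)] (new) -/
theorem unprojectedDense_of_mmCase_of_base_eq_paramCurve_master₂ (g₀ g₁ : Polynomial ℂ)
    (hd₀ : 2 ≤ g₀.natDegree) (hd₁ : 2 ≤ g₁.natDegree)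
    (h : (g₀.natDegree < g₁.natDegree ∧ (¬ g₀.natDegree ∣ g₁.natDegree ∨
        (g₁.leadingCoeff * (I / g₀.leadingCoeff) ^ (g₁.natDegree / g₀.natDegree)).re ≠ 0 ∨
        g₁.natDegree < (Polynomial.C (g₀.leadingCoeff ^ (g₁.natDegree / g₀.natDegree)) * g₁ -
            Polynomial.C g₁.leadingCoeff * g₀ ^ (g₁.natDegree / g₀.natDegree)).natDegree +
          g₀.natDegree)) ∨
      (g₁.natDegree < g₀.natDegree ∧ (¬ g₁.natDegree ∣ g₀.natDegree ∨
        (g₀.leadingCoeff * (I / g₁.leadingCoeff) ^ (g₀.natDegree / g₁.natDegree)).re ≠ 0 ∨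
        g₀.natDegree < (Polynomial.C (g₁.leadingCoeff ^ (g₀.natDegree / g₁.natDegree)) * g₀ -
            Polynomial.C g₀.leadingCoeff * g₁ ^ (g₀.natDegree / g₁.natDegree)).natDegree +
          g₁.natDegree)) ∨
      (g₁.natDegree = g₀.natDegree ∧ (g₁.leadingCoeff / g₀.leadingCoeff).im ≠ 0) ∨
      (g₁.natDegree = g₀.natDegree ∧ (g₁.leadingCoeff / g₀.leadingCoeff).im = 0 ∧
        Irrational (g₁.leadingCoeff / g₀.leadingCoeff).re ∧
        g₀.leadingCoeff * g₁.coeff (g₀.natDegree - 1) ≠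
          g₁.leadingCoeff * g₀.coeff (g₀.natDegree - 1)) ∨
      (g₁.natDegree = g₀.natDegree ∧ ∃ p q u v : ℤ, p * u + q * v = 1 ∧
        (p : ℂ) * g₀.leadingCoeff + (q : ℂ) * g₁.leadingCoeff = 0 ∧
        2 ≤ (Polynomial.C (p : ℂ) * g₀ + Polynomial.C (q : ℂ) * g₁).natDegree ∧
        (¬ (Polynomial.C (p : ℂ) * g₀ + Polynomial.C (q : ℂ) * g₁).natDegree ∣ g₀.natDegree ∨
          ((Polynomial.C (u : ℂ) * g₁ - Polynomial.C (v : ℂ) * g₀).leadingCoeff *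
              (I / (Polynomial.C (p : ℂ) * g₀ + Polynomial.C (q : ℂ) * g₁).leadingCoeff) ^
                (g₀.natDegree / (Polynomial.C (p : ℂ) * g₀ + Polynomial.C (q : ℂ) * g₁).natDegree)).re
            ≠ 0 ∨
          g₀.natDegree <
            (Polynomial.C ((Polynomial.C (p : ℂ) * g₀ + Polynomial.C (q : ℂ) * g₁).leadingCoeff ^
                  (g₀.natDegree / (Polynomial.C (p : ℂ) * g₀ + Polynomial.C (q : ℂ) * g₁).natDegree)) *
                (Polynomial.C (u : ℂ) * g₁ - Polynomial.C (v : ℂ) * g₀) -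
              Polynomial.C (Polynomial.C (u : ℂ) * g₁ - Polynomial.C (v : ℂ) * g₀).leadingCoeff *
                (Polynomial.C (p : ℂ) * g₀ + Polynomial.C (q : ℂ) * g₁) ^
                  (g₀.natDegree / (Polynomial.C (p : ℂ) * g₀ + Polynomial.C (q : ℂ) * g₁).natDegree)).natDegree +
            (Polynomial.C (p : ℂ) * g₀ + Polynomial.C (q : ℂ) * g₁).natDegree)))
    {W : Set (Fin 2 ⊕ Fin 2 → ℂ)} (hmm : MMCaseDimPiOneFree W)
    (hbase : zeroLocus ℂ (vanishingIdeal ℂ (projAdd '' (W ∩ torusLocus ℂ 2))) =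
      {x : Fin 2 → ℂ | ∃ t : ℂ, x 0 = g₀.eval t ∧ x 1 = g₁.eval t}) :
    UnprojectedDense W := by
  rcases h with ⟨hlt, hph⟩ | ⟨hgt, hph⟩ | ⟨heq, him⟩ | ⟨heq, him, hirrat, hsub⟩ |
    ⟨heq, p, q, u, v, hbez, hpq, hm, hreg⟩
  · exact unprojectedDense_of_mmCase_of_base_eq_paramCurve₃ g₀ g₁ hd₀ hlt hph hmm hbase
  · exact unprojectedDense_of_mmCase_of_base_eq_paramCurve₃_of_gt g₀ g₁ hd₁ hgt hph hmm hbase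
  · exact unprojectedDense_of_mmCase_of_base_eq_paramCurve_of_eq g₀ g₁ hd₀ heq him hmm hbase
  · exact unprojectedDense_of_mmCase_of_base_eq_curvedReal g₀ g₁ hd₀ heq him hirrat hsub hmm hbase
  · exact unprojectedDense_of_mmCase_of_base_eq_paramCurve_of_ratRatio₃ g₀ g₁ hbez hd₀ heq hpq
      rfl rfl hm hreg hmm hbase

end RatRatio

/-! ## Examples -/

section Examples

/-- `deg (i X⁶ + X⁴) = 6`. -/
theorem natDegree_C_I_mul_X_pow_six_add_X_pow_four :
    (Polynomial.C I * Polynomial.X ^ 6 + Polynomial.X ^ 4 : Polynomial ℂ).natDegree = 6 := by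
  rw [Polynomial.natDegree_add_eq_left_of_natDegree_lt] <;>
    simp [Polynomial.natDegree_C_mul_X_pow 6 I I_ne_zero]

/-- `lc (i X⁶ + X⁴) = i`. -/
theorem leadingCoeff_C_I_mul_X_pow_six_add_X_pow_four :
    (Polynomial.C I * Polynomial.X ^ 6 + Polynomial.X ^ 4 : Polynomial ℂ).leadingCoeff = I := by
  rw [Polynomial.leadingCoeff, natDegree_C_I_mul_X_pow_six_add_X_pow_four]
  simp [Polynomial.coeff_X_pow]

/-- The gap polynomial of `(t³, i t⁶ + t⁴)`: `1² (i t⁶ + t⁴) - i (t³)² = t⁴`, of degree `4 > 6 - 3`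
(while the sub-leading coefficients ARE proportional: `t⁵` is absent). -/
theorem gapPoly_cubic_sextic :
    (Polynomial.C ((Polynomial.X ^ 3 : Polynomial ℂ).leadingCoeff ^
          ((Polynomial.C I * Polynomial.X ^ 6 + Polynomial.X ^ 4 : Polynomial ℂ).natDegree /
            (Polynomial.X ^ 3 : Polynomial ℂ).natDegree)) *
        (Polynomial.C I * Polynomial.X ^ 6 + Polynomial.X ^ 4) -
      Polynomial.C (Polynomial.C I * Polynomial.X ^ 6 + Polynomial.X ^ 4 : Polynomial ℂ).leadingCoeff *
        (Polynomial.X ^ 3) ^ ((Polynomial.C I * Polynomial.X ^ 6 + Polynomial.X ^ 4 :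
          Polynomial ℂ).natDegree / (Polynomial.X ^ 3 : Polynomial ℂ).natDegree) :
        Polynomial ℂ) = Polynomial.X ^ 4 := by
  rw [natDegree_C_I_mul_X_pow_six_add_X_pow_four, leadingCoeff_C_I_mul_X_pow_six_add_X_pow_four]
  have hd3 : (Polynomial.X ^ 3 : Polynomial ℂ).natDegree = 3 := by simp
  have hlc3 : (Polynomial.X ^ 3 : Polynomial ℂ).leadingCoeff = 1 := by simp
  rw [hd3, hlc3]
  norm_num
  ring

/-- The curve `(x₁ - i x₀²)³ = x₀⁴` is `{(t³, i t⁶ + t⁴)}`. -/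
theorem iSexticCurve_eq_paramCurve :
    {x : Fin 2 → ℂ | (x 1 - I * x 0 ^ 2) ^ 3 = x 0 ^ 4} =
      {x : Fin 2 → ℂ | ∃ t : ℂ, x 0 = (Polynomial.X ^ 3 : Polynomial ℂ).eval t ∧
        x 1 = (Polynomial.C I * Polynomial.X ^ 6 + Polynomial.X ^ 4 : Polynomial ℂ).eval t} := by
  ext x
  simp only [Set.mem_setOf_eq, Polynomial.eval_pow, Polynomial.eval_X, Polynomial.eval_add,
    Polynomial.eval_mul, Polynomial.eval_C]
  constructor
  · intro h
    obtain ⟨s, hs⟩ : ∃ s : ℂ, s = x 1 - I * x 0 ^ 2 := ⟨_, rfl⟩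
    rw [← hs] at h
    by_cases h0 : x 0 = 0
    · have h1 : s = 0 := by
        have : s ^ 3 = 0 := by rw [h, h0]; ring
        exact pow_eq_zero_iff (by norm_num) |>.1 this
      refine ⟨0, by simp [h0], ?_⟩
      have : x 1 = I * x 0 ^ 2 := sub_eq_zero.1 (hs ▸ h1)
      rw [this, h0]; ring
    · have hs0 : s ≠ 0 := by
        intro hs0
        apply h0
        have : x 0 ^ 4 = 0 := by rw [← h, hs0]; ring
        exact pow_eq_zero_iff (by norm_num) |>.1 this
      -- `t = x₀³ / s²`: `t³ = x₀⁹/s⁶ = x₀⁹/x₀⁸ = x₀`, `t⁴ = x₀ t = x₀⁴/s² · … = s`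
      have e3 : (x 0 ^ 3 / s ^ 2) ^ 3 = x 0 := by
        rw [div_pow, div_eq_iff (pow_ne_zero 3 (pow_ne_zero 2 hs0))]
        have : (s ^ 2) ^ 3 = (s ^ 3) ^ 2 := by ring
        rw [this, h]; ring
      have e4 : (x 0 ^ 3 / s ^ 2) ^ 4 = s := by
        have : (x 0 ^ 3 / s ^ 2) ^ 4 = (x 0 ^ 3 / s ^ 2) ^ 3 * (x 0 ^ 3 / s ^ 2) := by ring
        rw [this, e3, mul_div_assoc', div_eq_iff (pow_ne_zero 2 hs0)]
        linear_combination -h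
      have e6 : (x 0 ^ 3 / s ^ 2) ^ 6 = x 0 ^ 2 := by
        have : (x 0 ^ 3 / s ^ 2) ^ 6 = ((x 0 ^ 3 / s ^ 2) ^ 3) ^ 2 := by ring
        rw [this, e3]
      exact ⟨x 0 ^ 3 / s ^ 2, by rw [e3], by rw [e6, e4, hs]; ring⟩
  · rintro ⟨t, h0, h1⟩
    rw [h1, h0]; ring

/-- **Every `W` of Mantova–Masser's case whose base curve is `(x₁ - i x₀²)³ = x₀⁴` has Zariski-dense
exponential points** (`(t³, i t⁶ + t⁴)`: `3 ∣ 6`, phase `Re(i · i²) = 0` VANISHES, sub-leading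
coefficients proportional (`t⁵` absent), gap polynomial `t⁴` of degree `4 > 6 - 3` — decided by the
Puiseux-gap theorem, not by gens 19–20). [cite: MantovaMasser2023, §1 Further remarks, p. 5 (the
question, open in general)] (new) -/
theorem unprojectedDense_of_mmCase_of_base_eq_iSexticCurve {W : Set (Fin 2 ⊕ Fin 2 → ℂ)}
    (hmm : MMCaseDimPiOneFree W)
    (hbase : zeroLocus ℂ (vanishingIdeal ℂ (projAdd '' (W ∩ torusLocus ℂ 2))) =
      {x : Fin 2 → ℂ | (x 1 - I * x 0 ^ 2) ^ 3 = x 0 ^ 4}) :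
    UnprojectedDense W := by
  rw [iSexticCurve_eq_paramCurve] at hbase
  have hd3 : (Polynomial.X ^ 3 : Polynomial ℂ).natDegree = 3 := by simp
  refine unprojectedDense_of_mmCase_of_base_eq_paramCurve₃ (Polynomial.X ^ 3)
    (Polynomial.C I * Polynomial.X ^ 6 + Polynomial.X ^ 4) (by rw [hd3]; norm_num)
    (by rw [hd3, natDegree_C_I_mul_X_pow_six_add_X_pow_four]; norm_num) (Or.inr (Or.inr ?_))
    hmm hbase
  rw [gapPoly_cubic_sextic, natDegree_C_I_mul_X_pow_six_add_X_pow_four, hd3]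
  norm_num

/-- `deg (X² + X) = 2`. -/
theorem natDegree_X_sq_add_X : (Polynomial.X ^ 2 + Polynomial.X : Polynomial ℂ).natDegree = 2 := by
  compute_degree!

/-- `lc (X² + X) = 1`. -/
theorem leadingCoeff_X_sq_add_X :
    (Polynomial.X ^ 2 + Polynomial.X : Polynomial ℂ).leadingCoeff = 1 := by
  rw [Polynomial.leadingCoeff, natDegree_X_sq_add_X]
  simp [Polynomial.coeff_X_pow, Polynomial.coeff_X]

/-- **Example (equal degrees, RATIONAL real leading ratio).**  The surface
`{(t², t² + t, y₀, y₁) : y₀ = t}`, i.e. `{x₀ = y₀², x₁ = y₀² + y₀}` over the curve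
`(x₁ - x₀)² = x₀` (leading ratio `1 ∈ ℚ`), is in Mantova–Masser's case and its exponential points
(`e^{y²} = y`) are Zariski dense.  Compare XXXII (`√2` in place of `1`): the gap theorem does not
see the arithmetic of the ratio. [cite: MantovaMasser2023, §1 Further remarks, p. 5 (the
question, open in general)] (new) -/
theorem unprojectedDensityQuestion_instance_unitCurve_y0_eq_t :
    MMCaseDimPiOneFree {w : Fin 2 ⊕ Fin 2 → ℂ | ∃ t : ℂ,
        w (Sum.inl 0) = (Polynomial.X ^ 2 : Polynomial ℂ).eval t ∧
        w (Sum.inl 1) = (Polynomial.X ^ 2 + Polynomial.X : Polynomial ℂ).eval t ∧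
        MvPolynomial.eval ![t, w (Sum.inr 0)] (X 1 - X 0 : MvPolynomial (Fin 2) ℂ) = 0} ∧
      UnprojectedDense {w : Fin 2 ⊕ Fin 2 → ℂ | ∃ t : ℂ,
        w (Sum.inl 0) = (Polynomial.X ^ 2 : Polynomial ℂ).eval t ∧
        w (Sum.inl 1) = (Polynomial.X ^ 2 + Polynomial.X : Polynomial ℂ).eval t ∧
        MvPolynomial.eval ![t, w (Sum.inr 0)] (X 1 - X 0 : MvPolynomial (Fin 2) ℂ) = 0} := by
  have hd2 : (Polynomial.X ^ 2 : Polynomial ℂ).natDegree = 2 := by simp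
  have hlc2 : (Polynomial.X ^ 2 : Polynomial ℂ).leadingCoeff = 1 := by simp
  rw [paramFibreCurveSurface_eq]
  refine unprojectedDensityQuestion_instance_paramSurface₃_of_y0_realRatio (Polynomial.X ^ 2)
    (Polynomial.X ^ 2 + Polynomial.X) (by rw [hd2]) (by rw [hd2, natDegree_X_sq_add_X])
    (by rw [hlc2, leadingCoeff_X_sq_add_X]; simp) ?_
    (irreducible_rename_castSucc₂ irreducible_X1_sub_X0) (support_rename_castSucc_y1 _)
    (exists_support_rename_castSucc_y0 X1_sub_X0_support_pair)
    (X1_sub_X0_fibres_infinite.mono ?_)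
  · rw [hlc2, leadingCoeff_X_sq_add_X, map_one, one_mul, one_mul,
      show (Polynomial.X ^ 2 + Polynomial.X - Polynomial.X ^ 2 : Polynomial ℂ) = Polynomial.X by ring,
      Polynomial.natDegree_X]
  · rintro t ⟨y, hy, hty⟩
    exact ⟨y, hy, by rw [eval_vec3_rename_castSucc]; exact hty⟩

end Examples

end Summit.Schanuel.Schanuel.Theorems
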